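import Literature.NumberTheory.DiophantineGeometry.CanonicalHeight
import HarnessLib

/-!
# Néron–Tate canonical heights — discharged facts

Proofs of named facts stated in `Literature.NumberTheory.DiophantineGeometry.CanonicalHeight`
(kept in a sibling file so that the statement file stays a definitions/named-facts file).

* `Literature.NumberTheory.DiophantineGeometry.IsCanonicalHeightFor.neronTatePairing_add_left_holds` discharges
  `Literature.NumberTheory.DiophantineGeometry.IsCanonicalHeightFor.neronTatePairing_add_left`: the Néron–Tate pairing
  `⟨P, Q⟩ = (ĥ (P + Q) - ĥ P - ĥ Q) / 2` of a canonical height `ĥ` (a function on an abelian group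
  satisfying the parallelogram law exactly) is additive in the first variable.
* `Literature.NumberTheory.DiophantineGeometry.isCanonicalHeightFor_canonicalHeightOf_holds` discharges
  `Literature.NumberTheory.DiophantineGeometry.isCanonicalHeightFor_canonicalHeightOf` (Tate's existence theorem): if a naive height
  `h : G → ℝ` satisfies the parallelogram law up to `O(1)`, then Tate's limit
  `canonicalHeightOf h P = lim h (2ⁿ • P) / 4ⁿ` exists, satisfies the parallelogram law exactly and
  differs from `h` by a bounded amount. Helper: `Literature.NumberTheory.DiophantineGeometry.dist_canonicalHeightSeq_succ_le` (the
  telescoping estimate).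

## References

* J. H. Silverman, *The Arithmetic of Elliptic Curves*, GTM 106, 2nd ed. 2009, Theorem VIII.9.3(c),
  p. 248 (bilinearity of `⟨P, Q⟩ = ĥ(P+Q) - ĥ(P) - ĥ(Q)`; the statement file's docstring cites part
  (e), which is the numbering of the bound `(deg f) ĥ = h_f + O(1)` in the 2nd edition — the
  bilinearity is part (c) there). Silverman's pairing has no factor `1/2`; additivity is invariant
  under scaling, so the vendored statement is faithful.
* J. H. Silverman, *op. cit.*, Proposition VIII.9.1 (Tate), pp. 247–248 (the sequence
  `4⁻ᴺ h([2ᴺ]P)` is Cauchy: `|4⁻ᴺ h([2ᴺ]P) − 4⁻ᴹ h([2ᴹ]P)| ≤ 4⁻ᴹ C` by telescoping from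
  `|h([2]Q) − 4h(Q)| ≤ C`) and Theorem VIII.9.3(a),(e), pp. 248–249 (parallelogram law by passing
  `[2ᴺ]P, [2ᴺ]Q` to the limit; `|ĥ − h| ≤ C` from `M = 0`).
* M. Hindry, J. H. Silverman, *Diophantine Geometry: an Introduction*, GTM 201, 2000,
  Theorem B.5.1 (the canonical height attached to a symmetric divisor via Tate's limit; the
  abstract-group form vendored in the statement file).
-/

open Filter Topology

namespace Literature.NumberTheory.DiophantineGeometry

variable {G : Type*} [AddCommGroup G]

/-- **Discharge of `IsCanonicalHeightFor.neronTatePairing_add_left`.** A function on an abelian group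
satisfying the parallelogram law exactly has a biadditive associated pairing:
`⟨P + Q, R⟩ = ⟨P, R⟩ + ⟨Q, R⟩`. The proof is the one printed in Silverman, AEC (2nd ed.)
Theorem VIII.9.3(c), p. 248: the alternating sum of the four parallelogram-law instances
`ĥ(P+Q+R) + ĥ(P+Q-R) = 2ĥ(P+Q) + 2ĥ(R)`, `ĥ(P+Q-R) + ĥ(P-Q+R) = 2ĥ(P) + 2ĥ(Q-R)`,
`ĥ(P+R+Q) + ĥ(P+R-Q) = 2ĥ(P+R) + 2ĥ(Q)`, `ĥ(Q+R) + ĥ(Q-R) = 2ĥ(Q) + 2ĥ(R)`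
(Silverman's `(P, R, Q)` is our `(P, Q, R)`; writing the second instance with `Q - R` rather than
`R - Q`, evenness of `ĥ` is not even needed). [cite: SilvermanAEC2009, Theorem VIII.9.3(c)] -/
theorem IsCanonicalHeightFor.neronTatePairing_add_left_holds :
    IsCanonicalHeightFor.neronTatePairing_add_left (G := G) := by
  intro h ĥ hc P Q R
  simp only [neronTatePairing]
  have h1 := hc.parallelogram_law (P + Q) R
  have h2 := hc.parallelogram_law P (Q - R)
  have h3 := hc.parallelogram_law (P + R) Q
  have h4 := hc.parallelogram_law Q R
  have e1 : P + (Q - R) = P + Q - R := by abel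
  have e2 : P + R + Q = P + Q + R := by abel
  have e3 : P + R - Q = P - (Q - R) := by abel
  rw [e1] at h2
  rw [e2, e3] at h3
  linarith

/-! ## Tate's existence theorem: discharge of `isCanonicalHeightFor_canonicalHeightOf` -/

/-- Tate's telescoping estimate: if `|h (2 • Q) - 4 h Q| ≤ C₁` for all `Q`, then the sequence
`n ↦ h (2ⁿ • P) / 4ⁿ` has consecutive differences bounded by `(C₁ / 4) (1/4)ⁿ`
(the `N = M + 1` case of `|4⁻ᴺ h([2ᴺ]P) − 4⁻ᴹ h([2ᴹ]P)| ≤ 4⁻ᴹ C`, which is all that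
`cauchySeq_of_le_geometric` needs). Silverman, AEC (2nd ed.) Proposition VIII.9.1 (proof), p. 247.
[cite: SilvermanAEC2009, Proposition VIII.9.1] -/
theorem dist_canonicalHeightSeq_succ_le {h : G → ℝ} {C₁ : ℝ}
    (hdup : ∀ Q : G, |h (2 • Q) - 4 * h Q| ≤ C₁) (P : G) (n : ℕ) :
    dist (h ((2 ^ n) • P) / 4 ^ n) (h ((2 ^ (n + 1)) • P) / 4 ^ (n + 1)) ≤
      C₁ / 4 * (1 / 4 : ℝ) ^ n := by
  have h4 : (0 : ℝ) < 4 ^ (n + 1) := by positivity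
  have e : (2 ^ (n + 1)) • P = 2 • ((2 ^ n) • P) := by rw [pow_succ', mul_nsmul']
  rw [Real.dist_eq, abs_sub_comm, e]
  have : h (2 • (2 ^ n) • P) / 4 ^ (n + 1) - h ((2 ^ n) • P) / 4 ^ n =
      (h (2 • (2 ^ n) • P) - 4 * h ((2 ^ n) • P)) / 4 ^ (n + 1) := by
    field_simp
    ring
  rw [this, abs_div, abs_of_pos h4, div_le_iff₀ h4]
  calc |h (2 • (2 ^ n) • P) - 4 * h ((2 ^ n) • P)| ≤ C₁ := hdup _
    _ = C₁ / 4 * (1 / 4 : ℝ) ^ n * 4 ^ (n + 1) := by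
      rw [pow_succ, one_div_pow]; field_simp

/-- **Tate's existence theorem** (discharge of `isCanonicalHeightFor_canonicalHeightOf`).
Proof following Silverman, AEC (2nd ed.) Proposition VIII.9.1 (pp. 247–248) and
Theorem VIII.9.3(a),(e) (pp. 248–249): the approximate parallelogram law with `Q = P` gives the
duplication bound `|h (2 • Q) - 4 h Q| ≤ C + |h 0|` (Silverman takes it from VIII.6.4(b) instead);
the telescoping estimate `dist_canonicalHeightSeq_succ_le` shows that `h (2ⁿ • P) / 4ⁿ` is Cauchy,
hence converges to its `limUnder`, which is `canonicalHeightOf h P` by definition, with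
`|canonicalHeightOf h P - h P| ≤ (C + |h 0|) / 4 / (1 - 1/4) = (C + |h 0|) / 3` (9.3(e), `M = 0`);
and the exact parallelogram law for `canonicalHeightOf h` follows by replacing `P, Q` by
`2ⁿ • P, 2ⁿ • Q` in the approximate law, dividing by `4ⁿ` and letting `n → ∞` (9.3(a)).
The evenness hypothesis `hneg` of the fact is not used (the fact as audited is thus slightly
weaker than what is proved here; it is discharged verbatim).
[cite: HindrySilverman2000, Theorem B.5.1];
[cite: SilvermanAEC2009, Proposition VIII.9.1, Theorem VIII.9.3] -/
theorem isCanonicalHeightFor_canonicalHeightOf_holds :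
    isCanonicalHeightFor_canonicalHeightOf (G := G) := by
  intro h hh _hneg
  obtain ⟨C, hC⟩ := hh
  -- Step 1: duplication estimate `|h (2 • Q) - 4 h Q| ≤ C + |h 0|` (parallelogram law at `Q = P`).
  have hdup : ∀ Q : G, |h (2 • Q) - 4 * h Q| ≤ C + |h 0| := fun Q ↦ by
    have hQ := hC Q Q
    rw [sub_self, ← two_nsmul] at hQ
    calc |h (2 • Q) - 4 * h Q| = |(h (2 • Q) + h 0 - 2 * h Q - 2 * h Q) - h 0| := by ring_nf
      _ ≤ |h (2 • Q) + h 0 - 2 * h Q - 2 * h Q| + |h 0| := abs_sub _ _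
      _ ≤ C + |h 0| := by gcongr
  -- Step 2 (VIII.9.1): Tate's sequence is Cauchy, hence converges to `canonicalHeightOf h P`.
  have hr : (1 / 4 : ℝ) < 1 := by norm_num
  have hstep := dist_canonicalHeightSeq_succ_le hdup
  have htends : ∀ P : G,
      Tendsto (fun n : ℕ ↦ h ((2 ^ n) • P) / 4 ^ n) atTop (𝓝 (canonicalHeightOf h P)) :=
    fun P ↦ (cauchySeq_of_le_geometric _ _ hr (hstep P)).tendsto_limUnder
  refine ⟨fun P Q ↦ ?_, ⟨(C + |h 0|) / 4 / (1 - 1 / 4), fun P ↦ ?_⟩⟩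
  · -- Step 4 (VIII.9.3(a)): exact parallelogram law by passing to the limit.
    have hlim : Tendsto (fun n : ℕ ↦ h ((2 ^ n) • (P + Q)) / 4 ^ n
        + h ((2 ^ n) • (P - Q)) / 4 ^ n - 2 * (h ((2 ^ n) • P) / 4 ^ n)
        - 2 * (h ((2 ^ n) • Q) / 4 ^ n)) atTop
        (𝓝 (canonicalHeightOf h (P + Q) + canonicalHeightOf h (P - Q)
          - 2 * canonicalHeightOf h P - 2 * canonicalHeightOf h Q)) :=
      (((htends (P + Q)).add (htends (P - Q))).sub ((htends P).const_mul 2)).sub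
        ((htends Q).const_mul 2)
    have hzero : Tendsto (fun n : ℕ ↦ h ((2 ^ n) • (P + Q)) / 4 ^ n
        + h ((2 ^ n) • (P - Q)) / 4 ^ n - 2 * (h ((2 ^ n) • P) / 4 ^ n)
        - 2 * (h ((2 ^ n) • Q) / 4 ^ n)) atTop (𝓝 0) := by
      have hgeom : Tendsto (fun n : ℕ ↦ C / (4 : ℝ) ^ n) atTop (𝓝 0) := by
        simpa [div_eq_mul_inv] using (tendsto_pow_atTop_nhds_zero_of_lt_one (r := (4 : ℝ)⁻¹)
          (by norm_num) (by norm_num)).const_mul C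
      refine (tendsto_zero_iff_abs_tendsto_zero _).2
        (squeeze_zero (fun n ↦ abs_nonneg _) (fun n ↦ ?_) hgeom)
      have h4 : (0 : ℝ) < 4 ^ n := by positivity
      rw [Function.comp_apply, nsmul_add, nsmul_sub]
      have : h ((2 ^ n) • P + (2 ^ n) • Q) / 4 ^ n + h ((2 ^ n) • P - (2 ^ n) • Q) / 4 ^ n
          - 2 * (h ((2 ^ n) • P) / 4 ^ n) - 2 * (h ((2 ^ n) • Q) / 4 ^ n) =
          (h ((2 ^ n) • P + (2 ^ n) • Q) + h ((2 ^ n) • P - (2 ^ n) • Q)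
            - 2 * h ((2 ^ n) • P) - 2 * h ((2 ^ n) • Q)) / 4 ^ n := by
        field_simp
      rw [this, abs_div, abs_of_pos h4]
      gcongr
      exact hC _ _
    have := tendsto_nhds_unique hlim hzero
    linarith
  · -- Step 3 (VIII.9.3(e)): bounded difference `|ĥ P - h P| ≤ (C + |h 0|) / 3`.
    have hd := dist_le_of_le_geometric_of_tendsto₀ _ _ hr (hstep P) (htends P)
    rw [Real.dist_eq] at hd
    simpa [abs_sub_comm] using hd

end Literature.NumberTheory.DiophantineGeometry
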